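import Summits.HodgeConjecture.CorCM.Geometry.BallQuotientUniformisedHolds
import Literature.NumberTheory.Automorphic.PicardCMSpecialCyclesAlgebraic
import Literature.NumberTheory.Automorphic.PicardSexticDatum
import HarnessLib

/-!
# The Picard–CM prerequisite bundle holds (count-neutral corollary file)

Topic `Summits/HodgeConjecture/CorCM/Geometry` (cell pub-hodgecm2, lane SPECIAL-CYCLES, seat b06; NEW path, one
writer). Everything here is a one-line KERNEL COMPOSITION of tree theorems:

* (ii-a) `PicardCM.BallQuotientUniformised` — `BallQuotient.ballQuotientUniformised_holds`
  (`Geometry/BallQuotientUniformisedHolds.lean`, seat b10);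
* (ii-b) `PicardCM.SpecialCyclesAlgebraic` — `PicardCM.specialCyclesAlgebraic_holds`
  (`Literature/NumberTheory/Automorphic/PicardCMSpecialCyclesAlgebraic.lean`: Kudla–Millson Lemma 1.1 + Chow +
  GAGA dimension comparison);
* (i), (iii), (iv) — `PicardCM.compactUnitaryQuotient_holds`, `cmAbelianVarietyRealised_holds`,
  `HeckeCharacter.exists_of_unitaryArchParams_iff_holds`.

Hence (ii) `PicardCM.BallQuotientAlgebraic` (`ballQuotientAlgebraic_holds`) and the whole bundle
`PicardCMPrerequisites` (`picardCMPrerequisites_holds`) hold HYPOTHESIS-FREE, through b10's packaging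
`ballQuotientAlgebraic_of_specialCyclesAlgebraic` / `picardCMPrerequisites_of_specialCyclesAlgebraic`. In particular
the tree's `UnitaryBallQuotientDatum 2 X` (with its four special-cycle fields) exists over every admissible
`(E, H, Γ)` (`exists_unitaryBallQuotientDatum`), and UNCONDITIONALLY for the explicit sextic Picard datum
`(E₇ = ℚ(ζ₇), H₇ = diag(1,1,-2cos(2π/7)), Γ₇ = Γ(3))` of `PicardSexticDatum` (`exists_sextic_unitaryBallQuotientDatum`,
`exists_nonempty_unitaryBallQuotientDatum`): the carrier structure of the tree's Bergeron–Millson–Moeglin statements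
(`BallQuotientHodgeClasses*`, `SpecialCycleClasses`) is INHABITED. No statement of the manuscripts adjudicated by the
cell is involved.
-/

set_option autoImplicit false

noncomputable section

open scoped ComplexOrder

namespace Summit.HodgeConjecture.CorCM.BallQuotient

open Literature.NumberTheory.Automorphic Literature.AlgebraicGeometry.ShimuraVarieties

/-- **(ii) `PicardCM.BallQuotientAlgebraic` holds**: compact Picard modular surfaces realise the tree's
`UnitaryBallQuotientDatum 2` — uniformisation (ii-a, Shafarevich IX §3.2 / Baily–Borel) and algebraic special cycles
(ii-b, Kudla–Millson Lemma 1.1 + Chow), both now tree theorems. [cite: KudlaMillson1990, Lemma 1.1, p. 128 and p. 133]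
[cite: GenestierNgo2020, Theorem 4.5.2] -/
theorem ballQuotientAlgebraic_holds : PicardCM.BallQuotientAlgebraic :=
  ballQuotientAlgebraic_of_specialCyclesAlgebraic PicardCM.specialCyclesAlgebraic_holds

/-- **The Picard–CM prerequisite bundle `PicardCMPrerequisites` holds, hypothesis-free** (all five records
(i), (ii-a), (ii-b), (iii), (iv) are theorems of the tree). [cite: KudlaMillson1990, Lemma 1.1, p. 128 and p. 133]
[cite: Shimura1998, §6.2 Theorem 3 (pp. 41–42)] -/
theorem picardCMPrerequisites_holds : PicardCMPrerequisites :=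
  picardCMPrerequisites_of_specialCyclesAlgebraic PicardCM.specialCyclesAlgebraic_holds

/-- **Existence of the full ball-quotient datum**: for every CM field `E ⊆ ℂ`, hermitian anisotropic `H ∈ M₃(E)` of
signature `(2,1)` at the distinguished place and definite elsewhere, and torsion-free congruence subgroup `Γ`, some
smooth projective surface `X/ℂ` carries a `UnitaryBallQuotientDatum 2 X` with these `E, H, Γ` (uniformisation AND
Zariski-closed special cycles of the expected codimension). [cite: BergeronMillsonMoeglin2016Balls, Introduction §1.1 and §1.7] -/
theorem exists_unitaryBallQuotientDatum (E : Subfield ℂ) [NumberField E] [NumberField.IsCMField E]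
    (H : Matrix (Fin 3) (Fin 3) E) (Γ : Subgroup (GL (Fin 3) E))
    (hH : ∀ i j, conjRingHom E (H i j) = H j i)
    (han : ∀ v : Fin 3 → E, hermForm (conjRingHom E) H v v = 0 → v = 0)
    (hsig : ∃ T : GL (Fin 3) ℂ,
      (T : Matrix (Fin 3) (Fin 3) ℂ).conjTranspose * H.map E.subtype * (T : Matrix (Fin 3) (Fin 3) ℂ) =
        signatureMatrix 2)
    (hpos : ∀ τ : E →+* ℂ, NumberField.InfinitePlace.mk τ ≠ NumberField.InfinitePlace.mk E.subtype →
      (H.map τ).PosDef)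
    (hcong : IsCongruenceSubgroup (conjRingHom E) H Γ) (htf : ∀ γ ∈ Γ, IsOfFinOrder γ → γ = 1) :
    ∃ (X : Literature.AlgebraicGeometry.Motives.SchemeOver ℂ) (D : UnitaryBallQuotientDatum 2 X),
      D.E = E ∧ D.H.map D.E.subtype = H.map E.subtype ∧
        D.Γ.map (Matrix.GeneralLinearGroup.map (D.E.subtype : D.E →+* ℂ)) =
          Γ.map (Matrix.GeneralLinearGroup.map (E.subtype : E →+* ℂ)) :=
  ballQuotientAlgebraic_holds E H Γ hH han hsig hpos hcong htf

/-- **A compact Picard modular surface with its special cycles EXISTS in the tree**: the explicit sextic datum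
`(E₇, H₇, Γ₇) = (ℚ(ζ₇), diag(1,1,-2cos(2π/7)), Γ(3))` of `PicardSexticDatum` is realised by a smooth projective surface
`X/ℂ` with a full `UnitaryBallQuotientDatum 2 X` (uniformisation `Γ₇\𝔹² ≅ X(ℂ)` and Zariski-closed special cycles) —
the theorem `ballQuotientAlgebraic_holds` applied to `PicardSextic.picardSextic_hypotheses`' conjuncts.
[cite: BergeronMillsonMoeglin2016Balls, Introduction §1.1 and §1.7] -/
theorem exists_sextic_unitaryBallQuotientDatum :
    ∃ (X : Literature.AlgebraicGeometry.Motives.SchemeOver ℂ) (D : UnitaryBallQuotientDatum 2 X),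
      D.E = PicardSextic.E₇ ∧ D.H.map D.E.subtype = PicardSextic.H₇.map PicardSextic.E₇.subtype ∧
        D.Γ.map (Matrix.GeneralLinearGroup.map (D.E.subtype : D.E →+* ℂ)) =
          PicardSextic.Γ₇.map (Matrix.GeneralLinearGroup.map (PicardSextic.E₇.subtype : PicardSextic.E₇ →+* ℂ)) :=
  ballQuotientAlgebraic_holds PicardSextic.E₇ PicardSextic.H₇ PicardSextic.Γ₇ PicardSextic.H₇_hermitian
    PicardSextic.H₇_anisotropic PicardSextic.H₇_signature PicardSextic.posDef_H₇_map
    PicardSextic.Γ₇_isCongruenceSubgroup PicardSextic.Γ₇_torsionFree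

/-- **Non-vacuity of `UnitaryBallQuotientDatum 2`**: some smooth projective complex surface carries a unitary
ball-quotient datum with its special cycles. [cite: BergeronMillsonMoeglin2016Balls, Introduction §1.1 and §1.7] -/
theorem exists_nonempty_unitaryBallQuotientDatum :
    ∃ X : Literature.AlgebraicGeometry.Motives.SchemeOver ℂ, Nonempty (UnitaryBallQuotientDatum 2 X) := by
  obtain ⟨X, D, -⟩ := exists_sextic_unitaryBallQuotientDatum
  exact ⟨X, ⟨D⟩⟩

end Summit.HodgeConjecture.CorCM.BallQuotient

end
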